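import Mathlib.Data.Sym.Card
import Mathlib.Data.Fintype.Vector
import Mathlib.Data.Nat.Choose.Bounds
import Summits.ValiantsHypothesis.ValiantsHypothesis.Theses.KPlusLogSqLaw
import Summits.ValiantsHypothesis.ValiantsHypothesis.Theorems.KPlusLogSqLawTropicalBRegimeCollapse
import Summits.ValiantsHypothesis.ValiantsHypothesis.Theorems.KPlusLogSqLawTropicalBStaticDiagonal
import Summits.ValiantsHypothesis.ValiantsHypothesis.Theorems.KPlusLogSqLawTropicalBPadding
import Summits.ValiantsHypothesis.ValiantsHypothesis.Theorems.KPlusLogSqLawTropicalBShadowCap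
import Summits.ValiantsHypothesis.ValiantsHypothesis.Theorems.KPlusLogSqLawTropicalBHessenbergSquareTower
import Summits.ValiantsHypothesis.ValiantsHypothesis.Theorems.MatrixDescartes.Negative.MatrixDescartesFalseOfTropicalMonster
import Summits.ValiantsHypothesis.ValiantsHypothesis.Theorems.LacunarySymmetroidMatrixDescartesCensusKLawBridge
import Summits.ValiantsHypothesis.ValiantsHypothesis.Theorems.LacunarySymmetroidMatrixDescartesCensusFrame
import Summits.ValiantsHypothesis.ValiantsHypothesis.Theorems.LacunarySymmetroidMatrixDescartesCensusClassicalRows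
import Summits.ValiantsHypothesis.ValiantsHypothesis.Theorems.LacunarySymmetroidAssembly
import Summits.ValiantsHypothesis.ValiantsHypothesis.Theorems.LacunarySymmetroidPencilTransfer
import Summits.ValiantsHypothesis.ValiantsHypothesis.Theorems.LacunarySymmetroidThetaWitness

set_option linter.dupNamespace false
set_option autoImplicit false

/-! ## Route «KPlusLogSqLaw» (route-ValiantsHypothesis-KPlusLogSqLaw): BC3 birth skeleton of crux `TropicalB` = item stmt-ValiantsHypothesis-19771
## — RE-CUT v2 (custody #2, conjb-2 g6, 2026-08-26; crux-workfile class, route text UNCHANGED rev 8 f0fe62816c62; lead R1401 «re-cut on the diagonal of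
## record + one genuinely different second stub, else declare no informative split»; J r5 flag «TB registered skeleton kernel-collapsed»).

HONEST FRAMING: a skeleton over an OPEN conjecture of the cell pub-symmetroid; every `stub_*` is `sorry`; nothing here asserts TropicalB, B, MatrixDescartes
or anything on VP ≠ VNP.  WHAT CHANGED AGAINST v1 (= g3 `TropicalB_birth_reg.lean` ee1aa5fc8a6813b6) and WHY:

* «NO INFORMATIVE REGISTERED SPLIT OF `TropicalB` EXISTS TODAY» (declared; desk record R1450 (b)): every cheap reduction of the crux in the tree
  is an EQUIVALENCE — `thinStub_iff_tropicalB`, `fatStub_iff_tropicalB`, `tropicalB_iff_logSqRow`, `tropicalB_iff_expSqrtTower`,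
  `tropicalB_iff_diagonal` (p432162), `tropicalB_iff_staticDiagonal` (p436380), `tropicalB_iff_permSteps` / `…_cardPerms` (p441329),
  `tropicalB_iff_unsigned` (p444755: signs are worth at most a factor two); val-sym-trop-p4 g2 REGIME-COLLAPSE memo R1/R2.  So the registered
  regime pair `stub_tropThin` / `stub_tropFat` is BOOKKEEPING (kept byte-identical: registered names, seats seated on them, and the kernel-checked
  glue `TropicalB_of`; each is ⟺ the crux).
* CONTENT STUB `stub_tropStaticDiagonal` — the crux in its CANONICAL dress (desk R1450 (b) / R1461 (a); trop-p4 g2 draft 019a98c96cdfd854 used the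
  plain diagonal): PLAIN PARAMETRIC ASSIGNMENT (static designs: one slope class per entry, `IsStatic ε`) on `2^s·s²` nodes with `s²` slope classes
  has at most `2^(C·s²)` sign-alternating unique optima.  HONEST LABEL: this IS the crux (`tropStaticDiagonal_iff_tropicalB` := p436380), NOT a
  split and NOT a T3 witness; registered so that the crux's one honest statement — Hrubeš–Yehudayoff Open Problem 1 restricted to slope matrices
  with ≤ log₂² n distinct entries, «≤ 2^(O(K)) · n^(O(log n)) breakpoints» — has a by-name target.
* ATTACK-FOOTHOLD STUB `stub_tropTowerLog` (labelled ATTACK FOOTHOLD, NOT a T3 witness — desk condition R1450 (b); T3[TropicalB] stays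
  witness-present on `tropicalB_hessenberg`): the FIRST OPEN TOWER HEIGHT `h = K·⌊log₂ K⌋`: `∃ C, ∀ K, T(K·⌊log₂ K⌋, K) ≤ 2^(C·K)` — O(1) bits
  per slope class.  BELOW the crux (`tropTowerLog_of_tropicalB`, via trop-p5's `squareTower_of_tropicalB` + padding `K·⌊log₂ K⌋ ≤ K²`); ABOVE
  counting (`tropRootLawAt_entropy` gives `K·(⌊log₂ ⌊log₂ K⌋⌋ + 4)` bits there); NOT known to give the crux back (REGIME-COLLAPSE R3: the tower
  `m = K·g(K)`, `g → ∞`, is a genuine hierarchy under the tree's paddings — «as far as anyone here can prove»).  The next height, the SQUARE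
  TOWER `T(K², K) ≤ 2^(C·K)` (desk docket D1a, J r5 (ii)), is cited by name, not registered: `squareTower_of_tropicalB`,
  `squareTower_of_shadowQuasiPolyCap`, `shadowBirkhoffIO_of_not_squareTower` (…TropicalBShadowCap).
* BC5 rungs of v1 kept (slope counting, off-window C = 3).

CHECKER SHAPE (ONBOARD §0): `TropicalB_of` concludes the UNFOLDED crux from the two regime statements; `TropicalB_skeleton : TropicalB` is the unique
hypothesis-free theorem concluding the crux BY NAME.  Sorries: exactly the four `stub_*`. -/

namespace Summit.ValiantsHypothesis.ValiantsHypothesis.Theses.KPlusLogSqLaw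

/-- local name for the tropical census row (δ-equal to helper part 1's `TropicalCensus.TropRootLawAt`, p406287). -/
def TropRow (m K B : ℕ) : Prop :=
  ∀ (d : Fin K → ℕ) (v ε : Fin m → Fin m → Fin K → ℤ) (n : ℕ) (θ : Fin (n + 1) → ℤ)
    (p : Fin (n + 1) → Equiv.Perm (Fin m) × (Fin m → Fin K)),
    (∀ i j l, (ε i j l).natAbs ≤ 1) → StrictMono θ →
    (∀ k, Summit.ValiantsHypothesis.ValiantsHypothesis.Theorems.MatrixDescartes.Negative.IsDominant d v ε (θ k) (p k)) →
    (∀ k : Fin n, Summit.ValiantsHypothesis.ValiantsHypothesis.Theorems.MatrixDescartes.Negative.termSign ε (p k.castSucc) *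
      Summit.ValiantsHypothesis.ValiantsHypothesis.Theorems.MatrixDescartes.Negative.termSign ε (p k.succ) < 0) → n ≤ B

theorem tropicalB_iff : TropicalB ↔ ∃ C : ℕ, ∀ m K : ℕ, TropRow m K (2 ^ (C * (K + Nat.log 2 m ^ 2))) := Iff.rfl

theorem lifting_iff : Lifting ↔ ∃ C : ℕ, ∀ m K n : ℕ, TropRow m K n →
    Summit.ValiantsHypothesis.ValiantsHypothesis.Theorems.LacunarySymmetroidMatrixDescartes.RealRootLawAt m K (2 ^ (C * K) * (n + 1)) :=
  Iff.rfl

end Summit.ValiantsHypothesis.ValiantsHypothesis.Theses.KPlusLogSqLaw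

/-! ## BC3 birth skeleton of crux `TropicalB` (inline variant) + BC5 rungs (all sorry-free except the two `stub_*`). -/

namespace Summit.ValiantsHypothesis.ValiantsHypothesis.Theses.KPlusLogSqLaw

open Summit.ValiantsHypothesis.ValiantsHypothesis.Theorems.MatrixDescartes.Negative
open scoped BigOperators
open Finset

theorem tropRow_mono {m K B B' : ℕ} (hBB' : B ≤ B') (h : TropRow m K B) : TropRow m K B' :=
  fun d v ε n θ p hε hθ hdom halt => (h d v ε n θ p hε hθ hdom halt).trans hBB'

/-- stub (TB, thin regime `K ≤ log₂² m`): the first open strip is `log₂ m + 1 < K ≤ log₂² m`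
(below it `tropRow_offWindow` is a theorem). -/
theorem stub_tropThin :
    ∃ C : ℕ, ∀ m K : ℕ, K ≤ Nat.log 2 m ^ 2 → TropRow m K (2 ^ (C * Nat.log 2 m ^ 2)) := by
  sorry

/-- stub (TB, fat regime `log₂² m ≤ K`): open for `log₂² m ≤ K < m` (at `m ≤ K` it is `tropRow_offWindow`). -/
theorem stub_tropFat :
    ∃ C : ℕ, ∀ m K : ℕ, Nat.log 2 m ^ 2 ≤ K → TropRow m K (2 ^ (C * K)) := by
  sorry

/-- BC3 composition for `TropicalB` (concluding the UNFOLDED crux, so that `TropicalB_skeleton` below is the unique theorem concluding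
`TropicalB` by name — `#h21_check_skeleton` takes the first such theorem): the two regimes glue with `C = C₁ + C₂`. -/
theorem TropicalB_of
    (h₁ : ∃ C : ℕ, ∀ m K : ℕ, K ≤ Nat.log 2 m ^ 2 → TropRow m K (2 ^ (C * Nat.log 2 m ^ 2)))
    (h₂ : ∃ C : ℕ, ∀ m K : ℕ, Nat.log 2 m ^ 2 ≤ K → TropRow m K (2 ^ (C * K))) :
    ∃ C : ℕ, ∀ m K : ℕ, TropRow m K (2 ^ (C * (K + Nat.log 2 m ^ 2))) := by
  obtain ⟨C₁, h₁⟩ := h₁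
  obtain ⟨C₂, h₂⟩ := h₂
  refine ⟨C₁ + C₂, fun m K => ?_⟩
  rcases le_total K (Nat.log 2 m ^ 2) with hK | hK
  · refine tropRow_mono (Nat.pow_le_pow_right (by norm_num) ?_) (h₁ m K hK)
    nlinarith [Nat.zero_le (C₂ * (K + Nat.log 2 m ^ 2)), Nat.zero_le (C₁ * K)]
  · refine tropRow_mono (Nat.pow_le_pow_right (by norm_num) ?_) (h₂ m K hK)
    nlinarith [Nat.zero_le (C₁ * (K + Nat.log 2 m ^ 2)), Nat.zero_le (C₂ * Nat.log 2 m ^ 2)]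

/-- SKELETON THEOREM (hypothesis-free form required by `#h21_check_skeleton`: stubs enter BY NAME): the crux from the two
declared stubs via `TropicalB_of`. -/
theorem TropicalB_skeleton : TropicalB := TropicalB_of stub_tropThin stub_tropFat

/-! ### CONTENT STUB (the crux in canonical dress; ⟺ the crux, NOT a split) and ATTACK-FOOTHOLD STUB (first open tower height) -/

/-- **CONTENT stub — `TropicalB` AS PLAIN PARAMETRIC ASSIGNMENT ON THE STATIC DIAGONAL:** every STATIC design (one slope class per entry) on
`2^s·s²` nodes with `s²` slope classes has at most `2^(C·s²)` sign-alternating unique optima along increasing integer slopes.  HONEST LABEL: this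
IS the crux (`tropStaticDiagonal_iff_tropicalB` = p436380 `tropicalB_iff_staticDiagonal`; port embedding one way, size/class padding the other) —
registered as the by-name target for the crux's canonical statement, NOT as a decomposition and NOT as a T3 witness.  In print: Hrubeš–Yehudayoff
2021 Open Problem 1 («is σ(DS_n) exponential?») restricted to slope matrices with ≤ log₂² n distinct entries; unnamed as such (T2 g6). -/
theorem stub_tropStaticDiagonal :
    ∃ C : ℕ, ∀ s : ℕ,
      Summit.ValiantsHypothesis.ValiantsHypothesis.Theorems.LacunarySymmetroidMatrixDescartes.TropicalCensus.TropRootLawAtStatic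
        (2 ^ s * s ^ 2) (s ^ 2) (2 ^ (C * s ^ 2)) := by
  sorry

/-- **ATTACK-FOOTHOLD stub (NOT a T3 witness; desk R1450 (b)) — the FIRST OPEN TOWER HEIGHT `h = K·⌊log₂ K⌋`:** `T(K·⌊log₂ K⌋, K) ≤ 2^(C·K)`
for all `K` (O(1) bits per slope class at row budget `m = K log K`).  BELOW the crux (`tropTowerLog_of_tropicalB`); ABOVE counting
(`tropRootLawAt_entropy`: `2^(K(⌊log₂⌊log₂ K⌋⌋ + 4))` there); not known to give the crux back (REGIME-COLLAPSE R3).  The next height `m = K²` (square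
tower) is trop-p5's `squareTower_of_tropicalB` / `squareTower_of_shadowQuasiPolyCap`. -/
theorem stub_tropTowerLog :
    ∃ C : ℕ, ∀ K : ℕ, TropRow (K * Nat.log 2 K) K (2 ^ (C * K)) := by
  sorry

/-- `TropRow` IS the tree's tropical census row (δ). -/
theorem tropRow_iff_tropRootLawAt (m K B : ℕ) :
    TropRow m K B ↔ Summit.ValiantsHypothesis.ValiantsHypothesis.Theorems.LacunarySymmetroidMatrixDescartes.TropicalCensus.TropRootLawAt m K B :=
  Iff.rfl

/-- honesty lemma: the content stub ⟺ the crux (p436380, by name) — why it is a canonical dress and not a split. -/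
theorem tropStaticDiagonal_iff_tropicalB :
    (∃ C : ℕ, ∀ s : ℕ,
      Summit.ValiantsHypothesis.ValiantsHypothesis.Theorems.LacunarySymmetroidMatrixDescartes.TropicalCensus.TropRootLawAtStatic
        (2 ^ s * s ^ 2) (s ^ 2) (2 ^ (C * s ^ 2))) ↔ TropicalB :=
  Summit.ValiantsHypothesis.ValiantsHypothesis.Theorems.KPlusLogSqLaw.tropicalB_iff_staticDiagonal.symm

/-- honesty lemma: the DIAGONAL OF RECORD (R1401) ⟺ the crux (p432162, by name). -/
theorem tropDiagonal_iff_tropicalB :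
    (∃ C : ℕ, ∀ s : ℕ, TropRow (2 ^ s) (s ^ 2) (2 ^ (C * s ^ 2))) ↔ TropicalB :=
  Summit.ValiantsHypothesis.ValiantsHypothesis.Theorems.KPlusLogSqLaw.tropicalB_iff_diagonal.symm

/-- honesty lemma: the crux ⇒ the first open tower height (trop-p5's `squareTower_of_tropicalB`, then padding `K·⌊log₂ K⌋ ≤ K²`
by `tropRootLawAt_of_le`); the foothold is BELOW the crux. -/
theorem tropTowerLog_of_tropicalB (hTB : TropicalB) : ∃ C : ℕ, ∀ K : ℕ, TropRow (K * Nat.log 2 K) K (2 ^ (C * K)) := by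
  obtain ⟨C, hC⟩ := Summit.ValiantsHypothesis.ValiantsHypothesis.Theorems.KPlusLogSqLaw.squareTower_of_tropicalB hTB
  refine ⟨C, fun K => ?_⟩
  have hle : K * Nat.log 2 K ≤ K ^ 2 := by
    rw [sq]; exact Nat.mul_le_mul_left K (Nat.log_le_self 2 K)
  exact Summit.ValiantsHypothesis.ValiantsHypothesis.Theorems.KPlusLogSqLaw.tropRootLawAt_of_le hle le_rfl (hC K)

/-- a second composition, for the record: the crux from its content stub alone (no split). -/
theorem tropicalB_of_staticDiagonalStub : TropicalB := tropStaticDiagonal_iff_tropicalB.mp stub_tropStaticDiagonal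

/-! ### BC5 rungs (theorems): the SLOPE-COUNTING law and TB OFF THE WINDOW `log₂ m + 1 < K < m` with `C = 3`. -/

variable {m K : ℕ}

/-- total exponent (slope) of a Leibniz term. -/
def slope (d : Fin K → ℕ) (p : Equiv.Perm (Fin m) × (Fin m → Fin K)) : ℤ := ∑ i, (d (p.2 i) : ℤ)

/-- the class multiset of a term, as an element of `Sym (Fin K) m`. -/
def classSym (p : Equiv.Perm (Fin m) × (Fin m → Fin K)) : Sym (Fin K) m :=
  ⟨(univ : Finset (Fin m)).val.map p.2, by simp⟩

/-- the slope of a term only depends on its class multiset. -/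
theorem slope_eq_of_classSym (d : Fin K → ℕ) (p : Equiv.Perm (Fin m) × (Fin m → Fin K)) :
    slope d p = (((classSym p) : Multiset (Fin K)).map fun l => (d l : ℤ)).sum := by
  unfold slope classSym
  simp only [Sym.coe_mk, Multiset.map_map]
  rfl

/-- **Slopes strictly increase along a dominant chain.** If `p` is the unique optimum at `θa` and `p' ≠ p` the unique
optimum at `θb > θa`, then `slope p < slope p'`. [folklore: convexity of the upper envelope] -/
theorem slope_lt_of_dominant (d : Fin K → ℕ) (v ε : Fin m → Fin m → Fin K → ℤ) {θa θb : ℤ} (hab : θa < θb)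
    {p p' : Equiv.Perm (Fin m) × (Fin m → Fin K)} (hne : p ≠ p') (ha : IsDominant d v ε θa p)
    (hb : IsDominant d v ε θb p') : slope d p < slope d p' := by
  have h1 := ha.2 p' (Ne.symm hne) hb.1
  have h2 := hb.2 p hne ha.1
  unfold tropWeight at h1 h2
  unfold slope
  set S := ∑ i, (d (p.2 i) : ℤ)
  set S' := ∑ i, (d (p'.2 i) : ℤ)
  set V := ∑ i, v (p.1 i) i (p.2 i)
  set V' := ∑ i, v (p'.1 i) i (p'.2 i)
  have h3 : (θb - θa) * (S' - S) > 0 := by nlinarith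
  by_contra hcon
  push Not at hcon
  have : (θb - θa) * (S' - S) ≤ 0 := mul_nonpos_of_nonneg_of_nonpos (by linarith) (by linarith)
  linarith

/-- **SLOPE-COUNTING LAW** (theorem): a dominant sign-alternating chain in format `(m, K)` has at most
`multichoose K m − 1 = C(K+m−1, m) − 1` breakpoints, because the class multisets of its terms are pairwise distinct.
This is the tropical twin of Descartes' bound by the number of monomials of `det F`. [folklore] -/
theorem tropRow_slopeCount (m K : ℕ) : TropRow m K (Nat.multichoose K m - 1) := by
  intro d v ε n θ p hε hθ hdom halt
  -- consecutive terms are distinct (their signs multiply to a negative number)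
  have hne : ∀ k : Fin n, p k.castSucc ≠ p k.succ := by
    intro k h
    have := halt k
    rw [h] at this
    exact absurd this (not_lt.mpr (mul_self_nonneg _))
  -- slopes strictly increase
  have hsm : StrictMono fun k => slope d (p k) := by
    rw [Fin.strictMono_iff_lt_succ]
    intro k
    exact slope_lt_of_dominant d v ε (hθ Fin.castSucc_lt_succ) (hne k) (hdom _) (hdom _)
  -- hence the class multisets are pairwise distinct
  have hinj : Function.Injective fun k => classSym (p k) := by
    intro k k' h
    apply hsm.injective
    simp only
    rw [slope_eq_of_classSym, slope_eq_of_classSym]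
    exact congrArg (fun M : Sym (Fin K) m => ((M : Multiset (Fin K)).map fun l => (d l : ℤ)).sum) h
  have hcard := Fintype.card_le_of_injective _ hinj
  rw [Fintype.card_fin, Sym.card_sym_eq_multichoose, Fintype.card_fin] at hcard
  omega

/-- binomial form of the slope-counting law. -/
theorem tropRow_choose (m K : ℕ) : TropRow m K ((K + m - 1).choose m - 1) := by
  rw [← Nat.multichoose_eq]; exact tropRow_slopeCount m K

/-- **Fat end of the window** (theorem): if `m ≤ K` then `T(m,K) ≤ 2^{2K}` — inside `TropKPlusLogSqLaw` with `C = 2`. -/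
theorem tropRow_fatEnd {m K : ℕ} (hmK : m ≤ K) : TropRow m K (2 ^ (2 * K)) := by
  refine tropRow_mono ?_ (tropRow_choose m K)
  calc (K + m - 1).choose m - 1 ≤ (K + m - 1).choose m := Nat.sub_le _ _
    _ ≤ 2 ^ (K + m - 1) := Nat.choose_le_two_pow _ _
    _ ≤ 2 ^ (2 * K) := Nat.pow_le_pow_right (by norm_num) (by omega)

/-- **Thin end of the window** (theorem): if `K ≤ log₂ m + 1` then `T(m,K) ≤ 2^{(log₂ m + 2)·log₂ m}` — inside
`TropKPlusLogSqLaw` with `C = 3`. -/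
theorem tropRow_thinEnd {m K : ℕ} (hK : K ≤ Nat.log 2 m + 1) :
    TropRow m K (2 ^ ((Nat.log 2 m + 2) * Nat.log 2 m)) := by
  rcases Nat.eq_zero_or_pos K with rfl | hKpos
  · -- no classes: at most one term (none if `m > 0`)
    refine tropRow_mono ?_ (tropRow_slopeCount m 0)
    rcases m with _ | m
    · simp
    · rw [Nat.multichoose_zero_succ]; simp
  rcases Nat.eq_zero_or_pos m with rfl | hmpos
  · refine tropRow_mono ?_ (tropRow_slopeCount 0 K)
    simp
  set L := Nat.log 2 m with hL
  have hm : m < 2 ^ (L + 1) := hL ▸ Nat.lt_pow_succ_log_self (by norm_num) m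
  refine tropRow_mono ?_ (tropRow_choose m K)
  have hsymm : (K + m - 1).choose m = (K + m - 1).choose (K - 1) :=
    Nat.choose_symm_of_eq_add (by omega)
  calc (K + m - 1).choose m - 1 ≤ (K + m - 1).choose (K - 1) := by rw [← hsymm]; exact Nat.sub_le _ _
    _ ≤ (K + m - 1) ^ (K - 1) := Nat.choose_le_pow _ _
    _ ≤ (2 ^ (L + 2)) ^ (K - 1) := by
        apply Nat.pow_le_pow_left
        have : K ≤ 2 ^ (L + 1) := by
          calc K ≤ L + 1 := hK
            _ ≤ 2 ^ (L + 1) := Nat.lt_two_pow_self.le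
        calc K + m - 1 ≤ 2 ^ (L + 1) + 2 ^ (L + 1) := by omega
          _ = 2 ^ (L + 2) := by ring
    _ = 2 ^ ((L + 2) * (K - 1)) := by rw [← pow_mul]
    _ ≤ 2 ^ ((L + 2) * L) := Nat.pow_le_pow_right (by norm_num) (Nat.mul_le_mul_left _ (by omega))

/-- **TB off the window** (theorem): outside `log₂ m + 1 < K < m` the tropical `K + log² m` law holds with `C = 3`. -/
theorem tropRow_offWindow (m K : ℕ) (h : K ≤ Nat.log 2 m + 1 ∨ m ≤ K) :
    TropRow m K (2 ^ (3 * (K + Nat.log 2 m ^ 2))) := by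
  have hLL : Nat.log 2 m ≤ Nat.log 2 m ^ 2 := Nat.le_self_pow two_ne_zero _
  have hsq : (Nat.log 2 m + 2) * Nat.log 2 m = Nat.log 2 m ^ 2 + 2 * Nat.log 2 m := by ring
  rcases h with h | h
  · refine tropRow_mono (Nat.pow_le_pow_right (by norm_num) ?_) (tropRow_thinEnd h)
    omega
  · refine tropRow_mono (Nat.pow_le_pow_right (by norm_num) ?_) (tropRow_fatEnd h)
    omega


/-- **BC5 rung of `TropicalB`** (theorem, C = 3): the tropical `K + log² m` law holds at every format off the window
`log₂ m + 1 < K < m` — i.e. `TropicalB` is EXACTLY the statement that one constant also closes the window. -/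
theorem TropicalB_rung_offWindow :
    ∀ m K : ℕ, (K ≤ Nat.log 2 m + 1 ∨ m ≤ K) → TropRow m K (2 ^ (3 * (K + Nat.log 2 m ^ 2))) :=
  tropRow_offWindow

end Summit.ValiantsHypothesis.ValiantsHypothesis.Theses.KPlusLogSqLaw
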